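/-
  HodgeLocusCensusInclusionRankLift.lean — pub-hlocus ENGINE B (ivhs-2, gen 55), PROBE 15e (successor material, R-L572 (b)/(d); probe-only, NOT filed).
  certified instances and evidence bearing on the general Hodge conjecture; no claim.

  KERNEL RANK THEOREMS (evidence class; linear algebra of inclusion matrices; nothing about HC). WILSON'S p-RANK THEOREM FOR THE INCLUSION MATRICES
  OF t-SUBSETS VS n-SUBSETS (`rank_incl_eq_sum`): over a field K with [CharP K p] (p prime or 0), for t ≤ n and t + n ≤ #α,
      rank W_{t,n}(α) = Σ_{j ≤ t, p ∤ C(n−j,t−j)} (C(#α,j) − C(#α,j−1)),    W_{t,n}(α) S T = [S ⊆ T] (W-convention of anchors 204/230/231/271)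
  [cite: Wilson1990, Thm 1] — R. M. Wilson, A diagonal form for the incidence matrices of t-subsets vs. k-subsets, Europ. J. Combin. 11 (1990) 609–615,
  Theorem 1 (there v := #α, k := n, the sum over i ≤ t with p ∤ C(k−i,t−i)). PROOF (elementary and basis-dependent; neither Wilson's diagonal form nor the
  Specht-module argument): PROBE 15a reduces the formula to the LIFTING HYPOTHESIS H, proved here (`inf_ker_le_map`) by LIFTING (`exists_lift`): for
  j ≤ i, V ⊆ V', #V' ≥ i + j, every z ∈ S_j(V) = (⨅_{k<j} ker ψ_{k←j}) ⊓ (⨅_{B ⊄ V} ker eval_B) (written out; no definition) is ψ_{j←i} x for some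
  x ∈ ⋂_{k<j} ker ψ_{k←i} supported in V' (induction on j and on #V: below 2j points z = 0 by VANISHING (15c); otherwise decompose del_a z (15d), lift the
  pieces by induction, push them up with Δ_{a,q}, recurse on V ∖ a). At V = V' = univ this is H. CENSUS USE: evaluates the blocks c!·W_{t,t+c} of
  anchor 230's `rank_mulDeltaPow_levels_eq_sum` in the modular regime c < p ≤ k of THEOREM L (c! a unit; Wilson's sum per block).
  3 theorems, 0 defs; imports PROBE 15a `…HodgeLocusCensusInclusionRankFiltration` and PROBE 15d `…HodgeLocusCensusInclusionRankDecomp` by name;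
  no sorries, axioms, instances or notation.
-/
import Summits.HodgeConjecture.HodgeConjecture.Theorems.HodgeLocusCensusInclusionRankFiltration
import Summits.HodgeConjecture.HodgeConjecture.Theorems.HodgeLocusCensusInclusionRankDecomp

set_option linter.dupNamespace false
set_option autoImplicit false

namespace Summit.HodgeConjecture.HodgeConjecture.HodgeLocus.Census.InclusionRankLift

open Module
open Summit.HodgeConjecture.HodgeConjecture.HodgeLocus.Census.InclusionRankPointOps
open Summit.HodgeConjecture.HodgeConjecture.HodgeLocus.Census.InclusionRankShadows
open Summit.HodgeConjecture.HodgeConjecture.HodgeLocus.Census.InclusionRankDecomp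
open Summit.HodgeConjecture.HodgeConjecture.HodgeLocus.Census.InclusionRankFiltration

variable (K : Type*) [Field K] {α : Type*} [Fintype α] [DecidableEq α]
/-! ## §6 LIFTING: `S_j(V) ⊆ ψ_{j←i}(F_j(M_i))`, with control of supports -/

/-- LIFTING: for `j ≤ i`, `i + j ≤ #V'`, `V ⊆ V'`, every `z ∈ S_j(V)` is `W_{j,i} x` for some `x` killed by every `W_{k,i}`, `k < j`,
and supported on the `i`-subsets of `V'`. -/
theorem exists_lift : ∀ (j i : ℕ) (V V' : Finset α) (z : {S : Finset α // S.card = j} → K), j ≤ i → i + j ≤ V'.card → V ⊆ V' →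
    z ∈ ((⨅ (k : ℕ) (_ : k < j),
          LinearMap.ker (Matrix.mulVecLin (Matrix.of fun (S : {S : Finset α // S.card = k}) (T : {S : Finset α // S.card = j}) =>
        if S.1 ⊆ T.1 then (1 : K) else 0))) ⊓
        (⨅ (B : {S : Finset α // S.card = j}) (_ : ¬ B.1 ⊆ V),
          LinearMap.ker (LinearMap.proj (R := K) (φ := fun _ : {S : Finset α // S.card = j} => K) B))) → ∃ x : {S : Finset α // S.card = i} → K,
      (∀ k : ℕ, k < j → Matrix.mulVecLin (Matrix.of fun (S : {S : Finset α // S.card = k}) (T : {S : Finset α // S.card = i}) =>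
        if S.1 ⊆ T.1 then (1 : K) else 0) x = 0) ∧ (∀ T : {S : Finset α // S.card = i}, ¬ T.1 ⊆ V' → x T = 0) ∧
      Matrix.mulVecLin (Matrix.of fun (S : {S : Finset α // S.card = j}) (T : {S : Finset α // S.card = i}) =>
        if S.1 ⊆ T.1 then (1 : K) else 0) x = z := by
  intro j
  induction j with
  | zero =>
    intro i V V' z _ hcard _ _
    obtain ⟨T₀, hT₀V', hT₀⟩ := Finset.exists_subset_card_eq (s := V') (n := i) (by omega)
    refine ⟨fun T => if T = ⟨T₀, hT₀⟩ then z ⟨∅, Finset.card_empty⟩ else 0,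
      fun k hk => absurd hk (Nat.not_lt_zero k), fun T hT => ?_, ?_⟩
    · show (if T = ⟨T₀, hT₀⟩ then z ⟨∅, Finset.card_empty⟩ else 0) = 0
      rw [if_neg]
      rintro rfl
      exact hT hT₀V'
    · funext C
      have hC : C = ⟨∅, Finset.card_empty⟩ := Subtype.ext (Finset.card_eq_zero.mp C.2)
      rw [incl_mulVecLin_apply]
      subst hC
      simp only [Finset.empty_subset, if_true]
      rw [Finset.sum_ite_eq' Finset.univ, if_pos (Finset.mem_univ _)]
  | succ j ih =>
    intro i' V₁ V' z₁ hji hcard hV₁V' hz₁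
    obtain ⟨i, rfl⟩ : ∃ i, i' = i + 1 := ⟨i' - 1, by omega⟩
    -- small supports carry only the zero vector (VANISHING)
    have small : ∀ (V : Finset α) (z : {S : Finset α // S.card = j + 1} → K), V.card < 2 * (j + 1) →
        z ∈ ((⨅ (k : ℕ) (_ : k < (j + 1)),
          LinearMap.ker (Matrix.mulVecLin (Matrix.of fun (S : {S : Finset α // S.card = k}) (T : {S : Finset α // S.card = (j + 1)}) =>
        if S.1 ⊆ T.1 then (1 : K) else 0))) ⊓
        (⨅ (B : {S : Finset α // S.card = (j + 1)}) (_ : ¬ B.1 ⊆ V),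
          LinearMap.ker (LinearMap.proj (R := K) (φ := fun _ : {S : Finset α // S.card = (j + 1)} => K) B))) → ∃ x : {S : Finset α // S.card = i + 1} → K,
          (∀ k : ℕ, k < j + 1 → Matrix.mulVecLin (Matrix.of fun (S : {S : Finset α // S.card = k}) (T : {S : Finset α // S.card = i + 1}) =>
        if S.1 ⊆ T.1 then (1 : K) else 0) x = 0) ∧
          (∀ T : {S : Finset α // S.card = i + 1}, ¬ T.1 ⊆ V' → x T = 0)
              ∧ Matrix.mulVecLin (Matrix.of fun (S : {S : Finset α // S.card = j + 1}) (T : {S : Finset α // S.card = i + 1}) =>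
        if S.1 ⊆ T.1 then (1 : K) else 0) x = z := by
      intro V z hV hz
      rw [mem_shadowKer] at hz
      refine ⟨0, fun k _ => map_zero _, fun T _ => rfl, ?_⟩
      rw [map_zero, eq_zero_of_card_lt K (j + 1) V hV z hz.2 hz.1]
    -- induction on `#V`
    suffices h : ∀ (n : ℕ) (V : Finset α) (z : {S : Finset α // S.card = j + 1} → K), V.card = n → V ⊆ V' →
        z ∈ ((⨅ (k : ℕ) (_ : k < (j + 1)),
          LinearMap.ker (Matrix.mulVecLin (Matrix.of fun (S : {S : Finset α // S.card = k}) (T : {S : Finset α // S.card = (j + 1)}) =>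
        if S.1 ⊆ T.1 then (1 : K) else 0))) ⊓
        (⨅ (B : {S : Finset α // S.card = (j + 1)}) (_ : ¬ B.1 ⊆ V),
          LinearMap.ker (LinearMap.proj (R := K) (φ := fun _ : {S : Finset α // S.card = (j + 1)} => K) B))) → ∃ x : {S : Finset α // S.card = i + 1} → K,
          (∀ k : ℕ, k < j + 1 → Matrix.mulVecLin (Matrix.of fun (S : {S : Finset α // S.card = k}) (T : {S : Finset α // S.card = i + 1}) =>
        if S.1 ⊆ T.1 then (1 : K) else 0) x = 0) ∧
          (∀ T : {S : Finset α // S.card = i + 1}, ¬ T.1 ⊆ V' → x T = 0)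
              ∧ Matrix.mulVecLin (Matrix.of fun (S : {S : Finset α // S.card = j + 1}) (T : {S : Finset α // S.card = i + 1}) =>
        if S.1 ⊆ T.1 then (1 : K) else 0) x = z from
      h V₁.card V₁ z₁ rfl hV₁V' hz₁
    intro n
    induction n with
    | zero =>
      intro V z hV _ hz
      exact small V z (by omega) hz
    | succ n ihn =>
      intro V z hVn hVV' hz
      by_cases hsmall : V.card < 2 * (j + 1)
      · exact small V z hsmall hz
      obtain ⟨a, haV⟩ : V.Nonempty := Finset.card_pos.mp (by omega)
      have hz' := (mem_shadowKer K (j + 1) V z).mp hz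
      have haV' : a ∈ V' := hVV' haV
      have hd1 : Matrix.mulVecLin (Matrix.of fun (B' : {S : Finset α // S.card = j}) (B : {S : Finset α // S.card = j + 1}) =>
        if B.1 = insert a B'.1 then (1 : K) else 0) z ∈ ((⨅ (k : ℕ) (_ : k < j),
          LinearMap.ker (Matrix.mulVecLin (Matrix.of fun (S : {S : Finset α // S.card = k}) (T : {S : Finset α // S.card = j}) =>
        if S.1 ⊆ T.1 then (1 : K) else 0))) ⊓
        (⨅ (B : {S : Finset α // S.card = j}) (_ : ¬ B.1 ⊆ (V.erase a)),
          LinearMap.ker (LinearMap.proj (R := K) (φ := fun _ : {S : Finset α // S.card = j} => K) B))) := del_mem K a j V z hz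
      have hcard₀ : (V.erase a).card = n := by
        have := Finset.card_erase_add_one haV
        omega
      -- the motive `P w :≡ ∃ x' ∈ F_{j+1}(M_{i+1}), supp x' ⊆ V', supp (ins_a w − ψ x') ⊆ V ∖ a`
      have hP0 : ∃ x' : {S : Finset α // S.card = i + 1} → K,
          (∀ k : ℕ, k < j + 1 → Matrix.mulVecLin (Matrix.of fun (S : {S : Finset α // S.card = k}) (T : {S : Finset α // S.card = i + 1}) =>
        if S.1 ⊆ T.1 then (1 : K) else 0) x' = 0) ∧
          (∀ T : {S : Finset α // S.card = i + 1}, ¬ T.1 ⊆ V' → x' T = 0) ∧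
          ∀ B : {S : Finset α // S.card = j + 1}, ¬ B.1 ⊆ V.erase a →
            (Matrix.mulVecLin (Matrix.of fun (B : {S : Finset α // S.card = j + 1}) (B' : {S : Finset α // S.card = j}) =>
        if B.1 = insert a B'.1 then (1 : K) else 0) (0 : {S : Finset α // S.card = j} → K)
            - Matrix.mulVecLin (Matrix.of fun (S : {S : Finset α // S.card = j + 1}) (T : {S : Finset α // S.card = i + 1}) =>
        if S.1 ⊆ T.1 then (1 : K) else 0) x') B = 0 :=
        ⟨0, fun k _ => map_zero _, fun T _ => rfl, fun B _ => by rw [map_zero, map_zero, sub_zero, Pi.zero_apply]⟩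
      have hPadd : ∀ x y : {S : Finset α // S.card = j} → K,
          (∃ x' : {S : Finset α // S.card = i + 1} → K,
            (∀ k : ℕ, k < j + 1 → Matrix.mulVecLin (Matrix.of fun (S : {S : Finset α // S.card = k}) (T : {S : Finset α // S.card = i + 1}) =>
        if S.1 ⊆ T.1 then (1 : K) else 0) x' = 0) ∧
            (∀ T : {S : Finset α // S.card = i + 1}, ¬ T.1 ⊆ V' → x' T = 0) ∧
            ∀ B : {S : Finset α // S.card = j + 1}, ¬ B.1 ⊆ V.erase a →
              (Matrix.mulVecLin (Matrix.of fun (B : {S : Finset α // S.card = j + 1}) (B' : {S : Finset α // S.card = j}) =>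
        if B.1 = insert a B'.1 then (1 : K) else 0) x - Matrix.mulVecLin (Matrix.of fun (S : {S : Finset α // S.card = j + 1}) (T : {S : Finset α // S.card = i + 1}) =>
        if S.1 ⊆ T.1 then (1 : K) else 0) x') B = 0) →
          (∃ x' : {S : Finset α // S.card = i + 1} → K,
            (∀ k : ℕ, k < j + 1 → Matrix.mulVecLin (Matrix.of fun (S : {S : Finset α // S.card = k}) (T : {S : Finset α // S.card = i + 1}) =>
        if S.1 ⊆ T.1 then (1 : K) else 0) x' = 0) ∧
            (∀ T : {S : Finset α // S.card = i + 1}, ¬ T.1 ⊆ V' → x' T = 0) ∧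
            ∀ B : {S : Finset α // S.card = j + 1}, ¬ B.1 ⊆ V.erase a →
              (Matrix.mulVecLin (Matrix.of fun (B : {S : Finset α // S.card = j + 1}) (B' : {S : Finset α // S.card = j}) =>
        if B.1 = insert a B'.1 then (1 : K) else 0) y - Matrix.mulVecLin (Matrix.of fun (S : {S : Finset α // S.card = j + 1}) (T : {S : Finset α // S.card = i + 1}) =>
        if S.1 ⊆ T.1 then (1 : K) else 0) x') B = 0) →
          (∃ x' : {S : Finset α // S.card = i + 1} → K,
            (∀ k : ℕ, k < j + 1 → Matrix.mulVecLin (Matrix.of fun (S : {S : Finset α // S.card = k}) (T : {S : Finset α // S.card = i + 1}) =>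
        if S.1 ⊆ T.1 then (1 : K) else 0) x' = 0) ∧
            (∀ T : {S : Finset α // S.card = i + 1}, ¬ T.1 ⊆ V' → x' T = 0) ∧
            ∀ B : {S : Finset α // S.card = j + 1}, ¬ B.1 ⊆ V.erase a →
              (Matrix.mulVecLin (Matrix.of fun (B : {S : Finset α // S.card = j + 1}) (B' : {S : Finset α // S.card = j}) =>
        if B.1 = insert a B'.1 then (1 : K) else 0) (x + y)
            - Matrix.mulVecLin (Matrix.of fun (S : {S : Finset α // S.card = j + 1}) (T : {S : Finset α // S.card = i + 1}) =>
        if S.1 ⊆ T.1 then (1 : K) else 0) x') B = 0) := by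
        rintro x y ⟨x', h1, h2, h3⟩ ⟨y', g1, g2, g3⟩
        refine ⟨x' + y', fun k hk => by rw [map_add, h1 k hk, g1 k hk, add_zero],
          fun T hT => by rw [Pi.add_apply, h2 T hT, g2 T hT, add_zero], fun B hB => ?_⟩
        have e1 := h3 B hB
        have e2 := g3 B hB
        rw [Pi.sub_apply] at e1 e2 ⊢
        rw [map_add, map_add, Pi.add_apply, Pi.add_apply]
        linear_combination e1 + e2
      have hPmem : ∀ q : α, q ∈ V.erase a → ∀ w : {S : Finset α // S.card = j} → K, w ∈ ((⨅ (k : ℕ) (_ : k < j),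
          LinearMap.ker (Matrix.mulVecLin (Matrix.of fun (S : {S : Finset α // S.card = k}) (T : {S : Finset α // S.card = j}) =>
        if S.1 ⊆ T.1 then (1 : K) else 0))) ⊓
        (⨅ (B : {S : Finset α // S.card = j}) (_ : ¬ B.1 ⊆ ((V.erase a).erase q)),
          LinearMap.ker (LinearMap.proj (R := K) (φ := fun _ : {S : Finset α // S.card = j} => K) B))) →
          ∃ x' : {S : Finset α // S.card = i + 1} → K,
            (∀ k : ℕ, k < j + 1 → Matrix.mulVecLin (Matrix.of fun (S : {S : Finset α // S.card = k}) (T : {S : Finset α // S.card = i + 1}) =>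
        if S.1 ⊆ T.1 then (1 : K) else 0) x' = 0) ∧
            (∀ T : {S : Finset α // S.card = i + 1}, ¬ T.1 ⊆ V' → x' T = 0) ∧
            ∀ B : {S : Finset α // S.card = j + 1}, ¬ B.1 ⊆ V.erase a →
              (Matrix.mulVecLin (Matrix.of fun (B : {S : Finset α // S.card = j + 1}) (B' : {S : Finset α // S.card = j}) =>
        if B.1 = insert a B'.1 then (1 : K) else 0) w - Matrix.mulVecLin (Matrix.of fun (S : {S : Finset α // S.card = j + 1}) (T : {S : Finset α // S.card = i + 1}) =>
        if S.1 ⊆ T.1 then (1 : K) else 0) x') B = 0 := by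
        intro q hq w hw
        have hw2 := ((mem_shadowKer K j _ w).mp hw).2
        have hqV' : q ∈ V'.erase a :=
          Finset.mem_erase.mpr ⟨Finset.ne_of_mem_erase hq, hVV' (Finset.mem_of_mem_erase hq)⟩
        have hcard'' : ((V'.erase a).erase q).card + 2 = V'.card := by
          rw [Finset.card_erase_of_mem hqV', Finset.card_erase_of_mem haV']
          omega
        have hsub'' : (V'.erase a).erase q ⊆ V' := (Finset.erase_subset q _).trans (Finset.erase_subset a V')
        obtain ⟨xq, hx1, hx2, hx3⟩ := ih i ((V.erase a).erase q) ((V'.erase a).erase q) w (by omega) (by omega)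
          (Finset.erase_subset_erase q (Finset.erase_subset_erase a hVV')) hw
        have ha'' : ∀ T : {S : Finset α // S.card = i}, a ∈ T.1 → xq T = 0 := fun T hT =>
          hx2 T (fun hsub => Finset.notMem_erase a V' (Finset.mem_of_mem_erase (hsub hT)))
        have hq'' : ∀ T : {S : Finset α // S.card = i}, q ∈ T.1 → xq T = 0 := fun T hT =>
          hx2 T (fun hsub => Finset.notMem_erase q (V'.erase a) (hsub hT))
        refine ⟨Matrix.mulVecLin (Matrix.of fun (B : {S : Finset α // S.card = i + 1}) (B' : {S : Finset α // S.card = i}) =>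
        if B.1 = insert a B'.1 then (1 : K) else 0) xq - Matrix.mulVecLin (Matrix.of fun (B : {S : Finset α // S.card = i + 1}) (B' : {S : Finset α // S.card = i}) =>
        if B.1 = insert q B'.1 then (1 : K) else 0) xq,
          fun k hk => incl_delta_eq_zero K a q i j xq ha'' hq'' hx1 k hk, fun T hT => ?_, fun B hB => ?_⟩
        · have t1 := supp_ins K a i ((V'.erase a).erase q) xq hx2 T
            (fun h => hT (h.trans (Finset.insert_subset_iff.mpr ⟨haV', hsub''⟩)))
          have t2 := supp_ins K q i ((V'.erase a).erase q) xq hx2 T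
            (fun h => hT (h.trans (Finset.insert_subset_iff.mpr ⟨Finset.mem_of_mem_erase hqV', hsub''⟩)))
          rw [Pi.sub_apply, t1, t2, sub_self]
        · rw [Pi.sub_apply, incl_delta_succ K a q i j xq ha'' hq'', hx3, Pi.sub_apply, sub_sub_cancel]
          exact supp_ins K q j ((V.erase a).erase q) w hw2 B (by rwa [Finset.insert_erase hq])
      -- run the DECOMPOSITION of `del_a z` through the motive
      obtain ⟨x', hx'1, hx'2, hx'3⟩ := biSup_induction K (V.erase a)
        (fun q => ((⨅ (k : ℕ) (_ : k < j),
          LinearMap.ker (Matrix.mulVecLin (Matrix.of fun (S : {S : Finset α // S.card = k}) (T : {S : Finset α // S.card = j}) =>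
        if S.1 ⊆ T.1 then (1 : K) else 0))) ⊓
        (⨅ (B : {S : Finset α // S.card = j}) (_ : ¬ B.1 ⊆ ((V.erase a).erase q)),
          LinearMap.ker (LinearMap.proj (R := K) (φ := fun _ : {S : Finset α // S.card = j} => K) B))))
        (fun w => ∃ x' : {S : Finset α // S.card = i + 1} → K,
          (∀ k : ℕ, k < j + 1 → Matrix.mulVecLin (Matrix.of fun (S : {S : Finset α // S.card = k}) (T : {S : Finset α // S.card = i + 1}) =>
        if S.1 ⊆ T.1 then (1 : K) else 0) x' = 0) ∧
          (∀ T : {S : Finset α // S.card = i + 1}, ¬ T.1 ⊆ V' → x' T = 0) ∧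
          ∀ B : {S : Finset α // S.card = j + 1}, ¬ B.1 ⊆ V.erase a →
            (Matrix.mulVecLin (Matrix.of fun (B : {S : Finset α // S.card = j + 1}) (B' : {S : Finset α // S.card = j}) =>
        if B.1 = insert a B'.1 then (1 : K) else 0) w - Matrix.mulVecLin (Matrix.of fun (S : {S : Finset α // S.card = j + 1}) (T : {S : Finset α // S.card = i + 1}) =>
        if S.1 ⊆ T.1 then (1 : K) else 0) x') B = 0)
        hP0 hPadd hPmem _ (mem_iSup_erase K j (V.erase a) _ (by omega) hd1)
      -- `z' := z − ψ x'` lies in `S_{j+1}(V ∖ a)`: induction hypothesis on `#V`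
      have hz'' : z - Matrix.mulVecLin (Matrix.of fun (S : {S : Finset α // S.card = j + 1}) (T : {S : Finset α // S.card = i + 1}) =>
        if S.1 ⊆ T.1 then (1 : K) else 0) x' ∈ ((⨅ (k : ℕ) (_ : k < (j + 1)),
          LinearMap.ker (Matrix.mulVecLin (Matrix.of fun (S : {S : Finset α // S.card = k}) (T : {S : Finset α // S.card = (j + 1)}) =>
        if S.1 ⊆ T.1 then (1 : K) else 0))) ⊓
        (⨅ (B : {S : Finset α // S.card = (j + 1)}) (_ : ¬ B.1 ⊆ (V.erase a)),
          LinearMap.ker (LinearMap.proj (R := K) (φ := fun _ : {S : Finset α // S.card = (j + 1)} => K) B))) := by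
        rw [mem_shadowKer]
        refine ⟨fun k hk => ?_, fun B hB => ?_⟩
        · rw [map_sub, hz'.1 k hk, ← LinearMap.comp_apply,
            incl_mulVecLin_comp K k (j + 1) (i + 1) (by omega) (by omega), LinearMap.smul_apply, hx'1 k hk,
            smul_zero, sub_zero]
        · have e1 := supp_sub_ins_del K a j V z hz'.2 B hB
          have e2 := hx'3 B hB
          rw [Pi.sub_apply] at e1 e2 ⊢
          linear_combination e1 + e2
      obtain ⟨x'', g1, g2, g3⟩ := ihn (V.erase a) _ hcard₀ ((Finset.erase_subset a V).trans hVV') hz''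
      refine ⟨x' + x'', fun k hk => by rw [map_add, hx'1 k hk, g1 k hk, add_zero],
        fun T hT => by rw [Pi.add_apply, hx'2 T hT, g2 T hT, add_zero], ?_⟩
      rw [map_add, g3]
      abel

/-! ## §7 the lifting hypothesis `H` of the filtration argument, and WILSON'S THEOREM -/

/-- **H.** `⋂_{k<j} ker ψ_{k←j} ≤ ψ_{j←i}(⋂_{k<j} ker ψ_{k←i})` for `j ≤ i`, `i + j ≤ #α`. -/
theorem inf_ker_le_map (j i : ℕ) (hji : j ≤ i) (hij : i + j ≤ Fintype.card α) :
    (Finset.range j).inf (fun k => LinearMap.ker (Matrix.mulVecLin (Matrix.of fun (S : {S : Finset α // S.card = k}) (T : {S : Finset α // S.card = j}) =>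
        if S.1 ⊆ T.1 then (1 : K) else 0))) ≤
      ((Finset.range j).inf (fun k => LinearMap.ker (Matrix.mulVecLin (Matrix.of fun (S : {S : Finset α // S.card = k}) (T : {S : Finset α // S.card = i}) =>
        if S.1 ⊆ T.1 then (1 : K) else 0)))).map
        (Matrix.mulVecLin (Matrix.of fun (S : {S : Finset α // S.card = j}) (T : {S : Finset α // S.card = i}) =>
        if S.1 ⊆ T.1 then (1 : K) else 0)) := by
  intro z hz
  rw [Submodule.mem_finsetInf] at hz
  have hzS : z ∈ ((⨅ (k : ℕ) (_ : k < j),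
          LinearMap.ker (Matrix.mulVecLin (Matrix.of fun (S : {S : Finset α // S.card = k}) (T : {S : Finset α // S.card = j}) =>
        if S.1 ⊆ T.1 then (1 : K) else 0))) ⊓
        (⨅ (B : {S : Finset α // S.card = j}) (_ : ¬ B.1 ⊆ (Finset.univ : Finset α)),
          LinearMap.ker (LinearMap.proj (R := K) (φ := fun _ : {S : Finset α // S.card = j} => K) B))) := by
    rw [mem_shadowKer]
    exact ⟨fun k hk => LinearMap.mem_ker.mp (hz k (Finset.mem_range.mpr hk)),
      fun B hB => absurd (Finset.subset_univ _) hB⟩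
  obtain ⟨x, hx1, _, hx3⟩ := exists_lift K j i Finset.univ Finset.univ z hji
    (by rw [Finset.card_univ]; exact hij) subset_rfl hzS
  refine Submodule.mem_map.mpr ⟨x, ?_, hx3⟩
  rw [Submodule.mem_finsetInf]
  intro k hk
  exact LinearMap.mem_ker.mpr (hx1 k (Finset.mem_range.mp hk))

/-- **WILSON'S `p`-RANK THEOREM** (R. M. Wilson, *A diagonal form for the incidence matrices of
`t`-subsets vs. `k`-subsets*, European J. Combin. 11 (1990) 609–615, Theorem 1), in the
`W`-convention of this census (`W_{t,n}(α) S T = [S ⊆ T]`, `#S = t`, `#T = n`): over a field of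
characteristic `p` (a prime, or `0`), for `t ≤ n` and `t + n ≤ #α`,
`rank W_{t,n}(α) = Σ_{j ≤ t, p ∤ C(n−j, t−j)} (C(#α, j) − C(#α, j−1))`. -/
theorem rank_incl_eq_sum (p : ℕ) [CharP K p] (t n : ℕ) (htn : t ≤ n) (hm : t + n ≤ Fintype.card α) :
    (Matrix.of fun (S : {S : Finset α // S.card = t}) (T : {S : Finset α // S.card = n}) => if S.1 ⊆ T.1 then (1 : K) else 0).rank =
      ∑ j ∈ Finset.range (t + 1), if p ∣ (n - j).choose (t - j) then 0
        else ((Fintype.card α).choose j - if j = 0 then 0 else (Fintype.card α).choose (j - 1)) :=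
  rank_incl_eq_sum_of_lift K (fun j i hji hij => inf_ker_le_map K j i hji hij) p t n htn hm

end Summit.HodgeConjecture.HodgeConjecture.HodgeLocus.Census.InclusionRankLift
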